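import Summits.Ventures.PercRepro.ProfileGapMonoThresholdGenericPred

/-!
# PercRepro — THE GENERIC DELETION LEMMA OF THE THRESHOLD FAMILY AT A WEAKLY GENERIC POINT: THE HARD CLASS SHRINKS
TO «EVERY POINT IS A COLOOP OF A SMALL COCIRCUIT» (p5, gen 25; `proofs/P5-GM1.md` §25(h); announced INBOX before
typing)

Call `z` WEAKLY `k`-generic (`WGenericQ N z k`) if every `X ⊆ E ∖ z` of rank `≤ k` has `z` in the closure of its
complement `E ∖ z ∖ X` OR in the closure of `X` itself — in cocircuit terms: every cocircuit `D ∋ z` with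
`ρ(D ∖ z) ≤ k` has `z ∈ cl(D ∖ z)`, i.e. `z` is not a coloop of `D`.  This is weaker than `GenericQ N z k`.
At a point with `WGenericQ N z (q − 1)` the bookkeeping of `ProfileGapMonoThresholdGenericPred` still closes:
* DEMAND: a `z`-free rank-`(q−1)` set `B` with `z ∉ cl(E' ∖ B)` has `N`-demand `d(m'+1)` against `d(m')` in `N ∖ z`
  (`m' := ρ(E' ∖ B)`, `d(m) := [t+1 ≤ m] · m`); by `(W)` such a `B` has `z ∈ cl(B)`, so it is exactly a set `B'` with
  `ρ_{N／z}(B') = q − 2` and `z ∉ cl(E' ∖ B')`, where the contraction formula `[t ≤ r] · (r+1)` (`r := ρ_{N／z}(E' ∖ B')`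
  `= m'`) overcounts the `N`-demand `d(m')` of `B' ∪ z` by the same `d(m'+1) − d(m')`; the two corrections cancel and
  `thresholdSum N q t = thresholdSum (N ∖ z) q t + thresholdSum (N ／ z) (q−1) (t−1) + #L'` holds exactly
  (`thresholdSum_eq_delete_add_contract_of_wGeneric`).
* SUPPLY: the only case of `S' ∈ T'_{t−1}(N ／ z)` that needed the genericity — `ρ_N(S') = q − 1`, `z ∉ cl(E' ∖ S')` —
  is impossible under `(W)` (`z ∈ cl(S')` would give `ρ(S' ∪ z) = q − 1 ≠ q`); the case `ρ_N(S') = q` goes through the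
  lost sets as before (`card_levelSetCoQ_delete_add_le_of_wGeneric`).
Hence **`delMonoT_of_wGenericQ`**: `DelMonoT N z q t` at every non-loop weakly `(q−1)`-generic point from `(I_{t−1})`
at co-rank `q − 1` for `N ／ z`.  Data (every matroid on `≤ 8` elements, every non-loop `z`, every `q ≥ 2`, every
`t ≥ q − 1`): `0` failures of the identity, the bound and `DelMonoT` on `22,536 / 20,545 / 19,764` instances at the
offsets `−1 / 0 / 1`, of which `5,031 / 3,113 / 2,607` are not `(q−1)`-generic.

* `WGenericQ`, `wGenericQ_of_genericQ`, `thresholdTerm_delete_of_wGeneric`, `thresholdTerm_insert_of_wGeneric`,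
  `lostSets_eq_overSets_of_wGeneric`, **`thresholdSum_eq_delete_add_contract_of_wGeneric`**,
  **`card_levelSetCoQ_delete_add_le_of_wGeneric`**, **`delMonoT_of_wGenericQ`**.
-/

open scoped Matroid

namespace PercRepro.Cogirth

open Finset ThmH Skew Shadow Profile

variable {α : Type} [DecidableEq α] {M : Matroid α} [M.Finite]

section WGeneric

variable {N : Matroid α} [N.Finite] {z : α} {q t : ℕ}

/-- **Weakly `k`-generic**: every subset of `E ∖ z` of rank `≤ k` has `z` in the closure of its complement in
`E ∖ z` or in its own closure (every cocircuit `D ∋ z` with `ρ(D ∖ z) ≤ k` has `z ∈ cl(D ∖ z)`). -/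
def WGenericQ (N : Matroid α) [N.Finite] (z : α) (k : ℕ) : Prop :=
  ∀ X ⊆ (gr N).erase z, rk N X ≤ k → z ∈ clF N ((gr N).erase z \ X) ∨ z ∈ clF N X

/-- A `k`-generic point is weakly `k`-generic. -/
theorem wGenericQ_of_genericQ {k : ℕ} (hg : GenericQ N z k) : WGenericQ N z k :=
  fun X hX hrk => Or.inl (hg X hX hrk)

/-- The complement of a `z`-free set in `gr N`. -/
theorem gr_sdiff_eq_insert_erase_sdiff (hz : z ∈ gr N) {B : Finset α} (hzB : z ∉ B) :
    gr N \ B = insert z ((gr N).erase z \ B) := by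
  ext x
  simp only [mem_sdiff, mem_insert, mem_erase]
  constructor
  · rintro ⟨hx, hxB⟩
    by_cases hxz : x = z
    · exact Or.inl hxz
    · exact Or.inr ⟨⟨hxz, hx⟩, hxB⟩
  · rintro (rfl | ⟨⟨_, hx⟩, hxB⟩)
    · exact ⟨hz, hzB⟩
    · exact ⟨hx, hxB⟩

/-- The `N`-demand of a `z`-free set `B` is its `N ∖ z`-demand plus the correction `d(m'+1) − d(m')` when `z` is a
coloop of `E ∖ B`, where `m' := ρ(E' ∖ B)` (written without subtraction: the `N ∖ z`-demand plus the
`[z ∉ cl(E' ∖ B)]`-correction equals the `N`-demand). -/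
theorem thresholdTerm_delete_of_wGeneric (hz : z ∈ gr N) {B : Finset α} (hB : B ⊆ (gr N).erase z) :
    (if t + 1 ≤ rk N (gr N \ B) then rk N (gr N \ B) else 0) =
      (if t + 1 ≤ rk (N ＼ ({z} : Set α)) (gr (N ＼ ({z} : Set α)) \ B) then
          rk (N ＼ ({z} : Set α)) (gr (N ＼ ({z} : Set α)) \ B) else 0) +
        (if z ∈ clF N ((gr N).erase z \ B) then 0 else
          ((if t + 1 ≤ rk N ((gr N).erase z \ B) + 1 then rk N ((gr N).erase z \ B) + 1 else 0) -
            (if t + 1 ≤ rk N ((gr N).erase z \ B) then rk N ((gr N).erase z \ B) else 0))) := by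
  have hzB : z ∉ B := fun h => (mem_erase.1 (hB h)).1 rfl
  have hX : (gr N).erase z \ B ⊆ (gr N).erase z := sdiff_subset
  have h1 : rk (N ＼ ({z} : Set α)) (gr (N ＼ ({z} : Set α)) \ B) = rk N ((gr N).erase z \ B) := by
    rw [gr_delete']
    exact rk_delete hX
  rw [h1, gr_sdiff_eq_insert_erase_sdiff hz hzB, rk_insert_eq hz (hX.trans (erase_subset _ _))]
  by_cases hcl : z ∈ clF N ((gr N).erase z \ B)
  · rw [if_pos hcl, if_pos hcl, add_zero]
  · rw [if_neg hcl, if_neg hcl]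
    split_ifs <;> omega

/-- For a rank-`(q−2)` set `B'` of `N ／ z`, the `N`-demand of `B' ∪ z` plus the `[z ∉ cl(E' ∖ B')]`-correction is the
contraction formula `[t ≤ r] · (r + 1)`, `r := ρ_{N／z}(E' ∖ B')`. -/
theorem thresholdTerm_insert_of_wGeneric (hzI : N.Indep {z}) {B' : Finset α} :
    (if t + 1 ≤ rk N (gr N \ insert z B') then rk N (gr N \ insert z B') else 0) +
      (if z ∈ clF N ((gr N).erase z \ B') then 0 else
          ((if t + 1 ≤ rk N ((gr N).erase z \ B') + 1 then rk N ((gr N).erase z \ B') + 1 else 0) -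
            (if t + 1 ≤ rk N ((gr N).erase z \ B') then rk N ((gr N).erase z \ B') else 0))) =
      (if t ≤ rk (N ／ ({z} : Set α)) (gr (N ／ ({z} : Set α)) \ B') then
        rk (N ／ ({z} : Set α)) (gr (N ／ ({z} : Set α)) \ B') + 1 else 0) := by
  have hz : z ∈ gr N := mem_gr_of_indep hzI
  have hY : (gr N).erase z \ B' ⊆ (gr N).erase z := sdiff_subset
  have h1 : gr N \ insert z B' = (gr N).erase z \ B' := by
    ext x
    simp only [mem_sdiff, mem_insert, mem_erase, not_or]
    tauto
  have h2 : rk (N ／ ({z} : Set α)) ((gr N).erase z \ B') + 1 = rk N (insert z ((gr N).erase z \ B')) :=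
    rk_contract_add_one hzI hY
  rw [rk_insert_eq hz (hY.trans (erase_subset _ _))] at h2
  rw [h1, gr_contract']
  by_cases hcl : z ∈ clF N ((gr N).erase z \ B')
  · rw [if_pos hcl] at h2
    rw [if_pos hcl, add_zero]
    split_ifs <;> omega
  · rw [if_neg hcl] at h2
    rw [if_neg hcl]
    split_ifs <;> omega

/-- **Under `(W_{q−1})` the lost `z`-free rank-`(q−1)` sets are exactly the rank-`(q−2)` sets of `N ／ z` whose
complement does not span `z`** (`2 ≤ q`). -/
theorem lostSets_eq_overSets_of_wGeneric (hzI : N.Indep {z}) (hw : WGenericQ N z (q - 1)) (hq : 2 ≤ q) :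
    (Rq N (q - 1)).filter (fun B => z ∉ B ∧ z ∉ clF N ((gr N).erase z \ B)) =
      (Rq (N ／ ({z} : Set α)) (q - 2)).filter (fun B' => z ∉ clF N ((gr N).erase z \ B')) := by
  have hz : z ∈ gr N := mem_gr_of_indep hzI
  ext B
  simp only [mem_filter, mem_Rq, gr_contract']
  constructor
  · rintro ⟨⟨hBg, hBr⟩, hzB, hcl⟩
    have hrk : rk N B = q - 1 := rk_eq_of_eRk_eq_cq hBr
    have hBE : B ⊆ (gr N).erase z := subset_erase.2 ⟨hBg, hzB⟩
    have hclB : z ∈ clF N B := (hw B hBE hrk.le).resolve_left hcl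
    have h1 := rk_contract_add_one hzI hBE
    rw [rk_insert_eq hz hBg, if_pos hclB, hrk] at h1
    refine ⟨⟨hBE, eRk_eq_of_rk_eq_cq (by omega)⟩, hcl⟩
  · rintro ⟨⟨hBE, hBr⟩, hcl⟩
    have hzB : z ∉ B := fun h => (mem_erase.1 (hBE h)).1 rfl
    have hBg : B ⊆ gr N := hBE.trans (erase_subset _ _)
    have hr' : rk (N ／ ({z} : Set α)) B = q - 2 := rk_eq_of_eRk_eq_cq hBr
    have h1 := rk_contract_add_one hzI hBE
    rw [hr', rk_insert_eq hz hBg] at h1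
    -- `ρ_N(B) = q − 1`: otherwise `ρ_N(B) = q − 2 ≤ q − 1` and `(W)` would put `z` in `cl(B)`, against `h1`
    have hrk : rk N B = q - 1 := by
      by_cases hclB : z ∈ clF N B
      · rw [if_pos hclB] at h1
        omega
      · rw [if_neg hclB] at h1
        have hle : rk N B ≤ q - 1 := by omega
        exact absurd ((hw B hBE hle).resolve_left hcl) hclB
    exact ⟨⟨hBg, eRk_eq_of_rk_eq_cq hrk⟩, hzB, hcl⟩

/-- The correction term of a set `B ⊆ E ∖ z`: `[z ∉ cl(E' ∖ B)] · (d(m'+1) − d(m'))`. -/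
noncomputable def lostCorr (N : Matroid α) [N.Finite] (z : α) (t : ℕ) (B : Finset α) : ℕ :=
  if z ∈ clF N ((gr N).erase z \ B) then 0 else
    ((if t + 1 ≤ rk N ((gr N).erase z \ B) + 1 then rk N ((gr N).erase z \ B) + 1 else 0) -
      (if t + 1 ≤ rk N ((gr N).erase z \ B) then rk N ((gr N).erase z \ B) else 0))

/-- **The threshold demand at a weakly `(q−1)`-generic non-loop point splits EXACTLY** (`2 ≤ q`, `1 ≤ t`):
`thresholdSum N q t = thresholdSum (N ∖ z) q t + thresholdSum (N ／ z) (q−1) (t−1) + #L'`. -/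
theorem thresholdSum_eq_delete_add_contract_of_wGeneric (hzI : N.Indep {z}) (hw : WGenericQ N z (q - 1))
    (hq : 2 ≤ q) (ht : 1 ≤ t) :
    thresholdSum N q t =
      thresholdSum (N ＼ ({z} : Set α)) q t +
        (thresholdSum (N ／ ({z} : Set α)) (q - 1) (t - 1) +
          ((Rq (N ／ ({z} : Set α)) (q - 2)).filter
            (fun B' => t ≤ rk (N ／ ({z} : Set α)) (gr (N ／ ({z} : Set α)) \ B'))).card) := by
  have hz : z ∈ gr N := mem_gr_of_indep hzI
  have e1 : q - 1 - 1 = q - 2 := by omega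
  have e2 : t - 1 + 1 = t := by omega
  -- the split of the demand of `N` at `z`
  have hsplit : thresholdSum N q t =
      ∑ B ∈ (Rq N (q - 1)).filter (fun B => z ∈ B),
          (if t + 1 ≤ rk N (gr N \ B) then rk N (gr N \ B) else 0) +
        ∑ B ∈ (Rq N (q - 1)).filter (fun B => z ∉ B),
          (if t + 1 ≤ rk N (gr N \ B) then rk N (gr N \ B) else 0) := by
    unfold thresholdSum
    rw [sum_filter_add_sum_filter_not]
  -- the `z`-free part: the demand of `N ∖ z` plus the corrections
  have hfree : ∑ B ∈ (Rq N (q - 1)).filter (fun B => z ∉ B),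
      (if t + 1 ≤ rk N (gr N \ B) then rk N (gr N \ B) else 0) =
      thresholdSum (N ＼ ({z} : Set α)) q t +
        ∑ B ∈ (Rq N (q - 1)).filter (fun B => z ∉ B), lostCorr N z t B := by
    unfold thresholdSum
    rw [Rq_delete_eq_filter, ← sum_add_distrib]
    refine sum_congr rfl (fun B hB => ?_)
    rw [mem_filter] at hB
    have hBE : B ⊆ (gr N).erase z := subset_erase.2 ⟨(mem_Rq.1 hB.1).1, hB.2⟩
    exact thresholdTerm_delete_of_wGeneric (t := t) hz hBE
  -- the through-`z` part: the contraction formula minus the corrections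
  have hthru : ∑ B ∈ (Rq N (q - 1)).filter (fun B => z ∈ B),
      (if t + 1 ≤ rk N (gr N \ B) then rk N (gr N \ B) else 0) +
      ∑ B' ∈ Rq (N ／ ({z} : Set α)) (q - 2), lostCorr N z t B' =
      thresholdSum (N ／ ({z} : Set α)) (q - 1) (t - 1) +
        ((Rq (N ／ ({z} : Set α)) (q - 2)).filter
          (fun B' => t ≤ rk (N ／ ({z} : Set α)) (gr (N ／ ({z} : Set α)) \ B'))).card := by
    rw [sum_Rq_filter_mem_contract hzI (by omega : 1 ≤ q - 1), e1, ← sum_add_distrib]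
    unfold thresholdSum
    rw [e1, e2, card_filter, ← sum_add_distrib]
    refine sum_congr rfl (fun B' _ => ?_)
    have h := thresholdTerm_insert_of_wGeneric (t := t) (B' := B') hzI
    unfold lostCorr
    rw [h]
    split_ifs <;> omega
  -- the corrections agree: the lost sets are the over-counted sets, and the correction vanishes elsewhere
  have hcorr : ∑ B ∈ (Rq N (q - 1)).filter (fun B => z ∉ B), lostCorr N z t B =
      ∑ B' ∈ Rq (N ／ ({z} : Set α)) (q - 2), lostCorr N z t B' := by
    have hL : ∑ B ∈ (Rq N (q - 1)).filter (fun B => z ∉ B), lostCorr N z t B =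
        ∑ B ∈ (Rq N (q - 1)).filter (fun B => z ∉ B ∧ z ∉ clF N ((gr N).erase z \ B)), lostCorr N z t B := by
      rw [← filter_filter]
      symm
      apply sum_filter_of_ne
      intro B _ hne
      by_contra hcl
      exact hne (if_pos hcl)
    have hR : ∑ B' ∈ Rq (N ／ ({z} : Set α)) (q - 2), lostCorr N z t B' =
        ∑ B' ∈ (Rq (N ／ ({z} : Set α)) (q - 2)).filter (fun B' => z ∉ clF N ((gr N).erase z \ B')),
          lostCorr N z t B' := by
      symm
      apply sum_filter_of_ne
      intro B _ hne
      by_contra hcl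
      exact hne (if_pos hcl)
    rw [hL, hR, lostSets_eq_overSets_of_wGeneric hzI hw hq]
  rw [hsplit, hfree]
  have := hthru
  rw [← hcorr] at this
  omega

/-- **The supply bound at a weakly `(q−1)`-generic non-loop point, at every co-rank threshold `t ≥ 1`**:
`#T_t(N ∖ z) + #T'_{t−1}(N ／ z) ≤ #T_t(N)`. -/
theorem card_levelSetCoQ_delete_add_le_of_wGeneric (hzI : N.Indep {z}) (hw : WGenericQ N z (q - 1))
    (hq : 1 ≤ q) (ht : 1 ≤ t) :
    (levelSetCoQ (N ＼ ({z} : Set α)) t q).card + (levelSetCoQ (N ／ ({z} : Set α)) (t - 1) (q - 1)).card ≤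
      (levelSetCoQ N t q).card := by
  have hz : z ∈ gr N := mem_gr_of_indep hzI
  set T' := levelSetCoQ (N ／ ({z} : Set α)) (t - 1) (q - 1) with hT'
  let lost : Finset α → Prop := fun S' => rk N S' = q ∧ rk N ((gr N).erase z \ S') < t
  let f : Finset α → Finset α := fun S' => if lost S' then S' else insert z S'
  have hmem : ∀ S' ∈ T', S' ⊆ (gr N).erase z ∧ rk (N ／ ({z} : Set α)) S' = q - 1 ∧
      t ≤ rk N (insert z ((gr N).erase z \ S')) := by
    intro S' hS'
    rw [hT', mem_levelSetCoQ, gr_contract'] at hS'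
    obtain ⟨⟨hS'g, hS'r⟩, hS'c⟩ := hS'
    have hr' : rk (N ／ ({z} : Set α)) S' = q - 1 := rk_eq_of_eRk_eq_cq hS'r
    have hY : (gr N).erase z \ S' ⊆ (gr N).erase z := sdiff_subset
    have h2 := rk_contract_add_one hzI hY
    exact ⟨hS'g, hr', by omega⟩
  have hrk : ∀ S' ∈ T', rk N S' ≤ q ∧ rk N (insert z S') = q := by
    intro S' hS'
    obtain ⟨hS'g, hr', _⟩ := hmem S' hS'
    have h := rk_contract_add_one hzI hS'g
    rw [hr'] at h
    have h2 := rk_mono' (M := N) (subset_insert z S')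
    exact ⟨by omega, by omega⟩
  have himage : T'.image f ⊆ levelSetCoQ N t q := by
    intro S hS
    rw [mem_image] at hS
    obtain ⟨S', hS', rfl⟩ := hS
    obtain ⟨hS'g, hr', hc⟩ := hmem S' hS'
    obtain ⟨hle, hins⟩ := hrk S' hS'
    have hzS' : z ∉ S' := fun h => (mem_erase.1 (hS'g h)).1 rfl
    have hY : (gr N).erase z \ S' ⊆ (gr N).erase z := sdiff_subset
    show (if lost S' then S' else insert z S') ∈ levelSetCoQ N t q
    by_cases hl : lost S'
    · rw [if_pos hl]
      obtain ⟨hrq, _⟩ := hl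
      rw [mem_levelSetCoQ]
      refine ⟨⟨hS'g.trans (erase_subset _ _), eRk_eq_of_rk_eq_cq hrq⟩, ?_⟩
      rw [gr_sdiff_eq_insert_erase_sdiff hz hzS']
      exact hc
    · rw [if_neg hl]
      have hgood : t ≤ rk N ((gr N).erase z \ S') := by
        by_cases hrq : rk N S' = q
        · by_contra hlt
          exact hl ⟨hrq, by omega⟩
        · -- `ρ_N(S') ≤ q − 1`: `(W)` puts `z` in `cl(E' ∖ S')` (`z ∈ cl(S')` is against `ρ(S' ∪ z) = q`)
          have hle' : rk N S' ≤ q - 1 := by omega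
          have hcl : z ∈ clF N ((gr N).erase z \ S') := by
            rcases hw S' hS'g hle' with h | h
            · exact h
            · exfalso
              have h3 : rk N (insert z S') = rk N S' := by
                rw [rk_insert_eq hz (hS'g.trans (erase_subset _ _)), if_pos h]
              omega
          have h3 : rk N (insert z ((gr N).erase z \ S')) = rk N ((gr N).erase z \ S') := by
            rw [rk_insert_eq hz (hY.trans (erase_subset _ _)), if_pos hcl]
          omega
      exact mem_levelSetCoQ_of_generic_good hzI (q := t) (u := q) hq hS' hgood
  have hinj : Set.InjOn f (T' : Set (Finset α)) := by
    intro S₁ hS₁ S₂ hS₂ heq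
    have hz₁ : z ∉ S₁ := fun h => (mem_erase.1 ((hmem S₁ hS₁).1 h)).1 rfl
    have hz₂ : z ∉ S₂ := fun h => (mem_erase.1 ((hmem S₂ hS₂).1 h)).1 rfl
    change (if lost S₁ then S₁ else insert z S₁) = (if lost S₂ then S₂ else insert z S₂) at heq
    by_cases h₁ : lost S₁ <;> by_cases h₂ : lost S₂
    · rw [if_pos h₁, if_pos h₂] at heq
      exact heq
    · rw [if_pos h₁, if_neg h₂] at heq
      exact absurd (heq ▸ mem_insert_self z S₂) hz₁
    · rw [if_neg h₁, if_pos h₂] at heq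
      exact absurd (heq.symm ▸ mem_insert_self z S₁) hz₂
    · rw [if_neg h₁, if_neg h₂] at heq
      rw [← erase_insert hz₁, ← erase_insert hz₂]
      exact congrArg (fun S => S.erase z) heq
  have hdisj : Disjoint (levelSetCoQ (N ＼ ({z} : Set α)) t q) (T'.image f) := by
    rw [disjoint_left]
    intro S hS hS'
    rw [mem_levelSetCoQ, gr_delete'] at hS
    obtain ⟨⟨hSg, _⟩, hSc⟩ := hS
    rw [mem_image] at hS'
    obtain ⟨S', hS'T, hfS⟩ := hS'
    change (if lost S' then S' else insert z S') = S at hfS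
    by_cases hl : lost S'
    · rw [if_pos hl] at hfS
      subst hfS
      obtain ⟨_, hlt⟩ := hl
      have hY : (gr N).erase z \ S' ⊆ (gr N).erase z := sdiff_subset
      rw [rk_delete hY] at hSc
      omega
    · rw [if_neg hl] at hfS
      subst hfS
      exact (mem_erase.1 (hSg (mem_insert_self z S'))).1 rfl
  calc (levelSetCoQ (N ＼ ({z} : Set α)) t q).card + T'.card
      = (levelSetCoQ (N ＼ ({z} : Set α)) t q).card + (T'.image f).card := by
          rw [card_image_of_injOn hinj]
    _ = ((levelSetCoQ (N ＼ ({z} : Set α)) t q) ∪ T'.image f).card := by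
          rw [card_union_of_disjoint hdisj]
    _ ≤ (levelSetCoQ N t q).card :=
          card_le_card (union_subset (levelSetCoQ_delete_subset_gen z t q) himage)

/-- **Deletion monotonicity of the threshold gap at a non-loop weakly `(q−1)`-generic point, from the family one
co-rank down** (`2 ≤ q`, `q − 1 ≤ t`): `DelMonoT N z q t` follows from `(I_{t−1})` at co-rank `q − 1` for `N ／ z`. -/
theorem delMonoT_of_wGenericQ (hzI : N.Indep {z}) (hw : WGenericQ N z (q - 1)) (hq : 2 ≤ q)
    (hqt : q - 1 ≤ t) (h : ThresholdIneq (N ／ ({z} : Set α)) (q - 1) (t - 1)) : DelMonoT N z q t := by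
  unfold DelMonoT
  rw [thresholdSum_eq_delete_add_contract_of_wGeneric hzI hw hq (by omega)]
  unfold ThresholdIneq at h
  have e1 : q - 1 - 1 = q - 2 := by omega
  have e2 : t - 1 + 1 = t := by omega
  have hsupply := card_levelSetCoQ_delete_add_le_of_wGeneric (t := t) hzI hw (by omega) (by omega)
  set L' := (Rq (N ／ ({z} : Set α)) (q - 2)).filter
    (fun B' => t ≤ rk (N ／ ({z} : Set α)) (gr (N ／ ({z} : Set α)) \ B')) with hL'
  have hLsum : t * L'.card ≤ thresholdSum (N ／ ({z} : Set α)) (q - 1) (t - 1) := by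
    unfold thresholdSum
    rw [e1, e2, hL', card_filter, mul_sum]
    refine sum_le_sum (fun B' _ => ?_)
    split_ifs <;> omega
  have hT' : L'.card ≤ (levelSetCoQ (N ／ ({z} : Set α)) (t - 1) (q - 1)).card := by
    have h3 : t * L'.card ≤ t * (levelSetCoQ (N ／ ({z} : Set α)) (t - 1) (q - 1)).card := by
      calc t * L'.card ≤ thresholdSum (N ／ ({z} : Set α)) (q - 1) (t - 1) := hLsum
        _ ≤ (q - 1) * (levelSetCoQ (N ／ ({z} : Set α)) (t - 1) (q - 1)).card := h
        _ ≤ t * (levelSetCoQ (N ／ ({z} : Set α)) (t - 1) (q - 1)).card :=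
            Nat.mul_le_mul_right _ (by omega)
    exact Nat.le_of_mul_le_mul_left h3 (by omega)
  have hA : thresholdSum (N ／ ({z} : Set α)) (q - 1) (t - 1) + L'.card ≤
      q * (levelSetCoQ (N ／ ({z} : Set α)) (t - 1) (q - 1)).card := by
    have hq1 : (q - 1) * (levelSetCoQ (N ／ ({z} : Set α)) (t - 1) (q - 1)).card +
        (levelSetCoQ (N ／ ({z} : Set α)) (t - 1) (q - 1)).card =
        q * (levelSetCoQ (N ／ ({z} : Set α)) (t - 1) (q - 1)).card := by
      have hq' : q - 1 + 1 = q := Nat.sub_add_cancel (by omega : 1 ≤ q)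
      calc (q - 1) * (levelSetCoQ (N ／ ({z} : Set α)) (t - 1) (q - 1)).card +
            (levelSetCoQ (N ／ ({z} : Set α)) (t - 1) (q - 1)).card
          = (q - 1 + 1) * (levelSetCoQ (N ／ ({z} : Set α)) (t - 1) (q - 1)).card := by ring
        _ = q * (levelSetCoQ (N ／ ({z} : Set α)) (t - 1) (q - 1)).card := by rw [hq']
    omega
  have hB : q * (levelSetCoQ (N ＼ ({z} : Set α)) t q).card +
      q * (levelSetCoQ (N ／ ({z} : Set α)) (t - 1) (q - 1)).card ≤ q * (levelSetCoQ N t q).card := by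
    rw [← Nat.mul_add]
    exact Nat.mul_le_mul_left q hsupply
  omega

end WGeneric

end PercRepro.Cogirth
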